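import Mathlib.LinearAlgebra.BilinearForm.Orthogonal
import Mathlib.LinearAlgebra.Matrix.BilinearForm
import Mathlib.LinearAlgebra.FiniteDimensional.Lemmas
import Mathlib.Algebra.Polynomial.Roots
import Mathlib.RingTheory.Coprime.Basic
import Mathlib.Tactic.Linarith
import Mathlib.Tactic.Ring
import Mathlib.Tactic.LinearCombination
import HarnessLib

/-!
# Prym–Torelli at the Castelnuovo boundary: the Clifford / isotropy skeleton (WEIL-2 gen 44, CLIFFORD-G44, fact-free)

research route, not a corollary; conditional on HC_CM plus one named minimal statement.

Cell `pub-hodge-ring2-ab-*` (ALL ABELIAN VARIETIES), seat WEIL-2 gen 44, account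
`run/shared/lean/pub/pub-hodge-ring2/pub-hodge-ring2-ab-weil-2/CLIFFORD-G44.md`.

Informal setting (PRYM-G42 §1, BRILLNOETHER-G43 §1, CLIFFORD-G44 §1).  At `f = 12` over `ℙ¹` (`G = ℤ/12 ⋊ ⟨h⟩`, `C' = C/N`
hyperelliptic of genus `g'` with involution `ι`, Weierstrass set `W`, `|W| = 2g'+2`) the codifferential of the `K`-piece period map at
a member is the `ι`-trace of the product `H⁰(K'+D₀) ⊗ H⁰(K'+B'−D₀) → H⁰(2K'+B')`.  CLIFFORD-G44 rewrites it as a pairing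
`H⁰(L) × H⁰(L ⊗ ε_M) → k^{W∖M}`, `(g, g') ↦ (g(w) g'(w))_w` (LEMMA W), so that a rank defect produces a non-zero diagonal form
`Σ α_w z_w z'_w` for which the two evaluation images are orthogonal; the dimension bound for orthogonal subspaces of a
non-degenerate form (`finrank_add_finrank_le_of_orthogonal` below) and Clifford's theorem then force `2 h⁰ = deg + 2` for two line
bundles differing by the 2-torsion class `ε_M`, which pins the deficient members down exactly (THEOREMS H, H′, H″ of the account:
`(k,m) = (2,0)`: `D₀ ∈ D_∞ + J[2]∖0`; `(1,2)`, `(0,4)`: none; `(0,2)`: `2D₀ ∼ D_∞`, `D₀ ∉ {w,w'}`), and the class conditions of the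
non-split data exclude all of them: every positive-dimensional non-split datum at `f = 12/ℙ¹` is immersive at EVERY member.
This file kernel-checks the linear algebra and the bookkeeping:
* `finrank_add_finrank_le_of_orthogonal`, `finrank_add_le_of_eval_orthogonal`: LEMMA Λ (orthogonal subspaces of a non-degenerate
  form; the `h⁰` form used in the account);
* `diagonal_nondegenerate`, `hyperbolic_nondegenerate`: the local model forms (evaluation at a Weierstrass point / at a fibre);
* `clifford_squeeze_two`, `clifford_squeeze_one`: the arithmetic end-game (`s = 2`: both bundles Clifford-extremal; `s = 1`: the
  three sub-cases);
* `support_bound_20`, `support_bound_12`, `support_bound_04`, `support_bound_02`: the degree windows `0 ≤ d ≤ 2g'−1` per `(k,m)`;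
* `eq_zero_of_coprime_of_natDegree_lt`, `corank_one_counts`: the direct-sum computation giving corank EXACTLY one at the deficient
  classes;
* `eval_injective_of_card`: `Pol_{≤ N} ↪ k^{N+1}` (the identification of the trace target with functions on `W`);
* `tprime_table_20`, `torsor_relations_20`, `torsor_relations_02`: the residue arithmetic of the class conditions
  (`e·(D₀ − D_∞) ∼ ιP − P`, `D₀ = w + X`, `X ∈ J[e]`).

0 sorry, no `def`, no named fact; `HC_CM` does not occur.
-/

namespace Summit.HodgeConjecture.Ring2AbelianAll.PrymTorelliClifford

section linalg

variable {F : Type*} [Field F] {W : Type*} [AddCommGroup W] [Module F W] [FiniteDimensional F W]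

/-- LEMMA Λ (isotropy bound): if `U` and `U'` are orthogonal for a non-degenerate bilinear form on a finite-dimensional space
`W`, then `dim U + dim U' ≤ dim W`.  (`U' ≤ U^⊥` and `dim U^⊥ = dim W − dim U`.)  [CLIFFORD-G44 §1.3]
research route, not a corollary; conditional on HC_CM plus one named minimal statement. -/
theorem finrank_add_finrank_le_of_orthogonal (B : LinearMap.BilinForm F W) (hB : B.Nondegenerate)
    (U U' : Submodule F W) (h : ∀ u ∈ U, ∀ u' ∈ U', B u u' = 0) :
    Module.finrank F U + Module.finrank F U' ≤ Module.finrank F W := by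
  have hle : U' ≤ B.orthogonal U := fun u' hu' =>
    (LinearMap.BilinForm.mem_orthogonal_iff).2 fun u hu => h u hu u' hu'
  have h1 := Submodule.finrank_mono hle
  have h2 := LinearMap.BilinForm.finrank_orthogonal hB U
  have h3 := Submodule.finrank_le U
  omega

variable {V V' : Type*} [AddCommGroup V] [Module F V] [FiniteDimensional F V] [AddCommGroup V'] [Module F V']
  [FiniteDimensional F V']

/-- LEMMA Λ in the form used: `e : H⁰(L) → k^Z`, `e' : H⁰(L') → k^Z` the evaluation (jet) maps along `Z`, `B` the
non-degenerate local pairing on `k^Z`; if `B(e g, e' g') = 0` for all `g, g'` then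
`h⁰(L) + h⁰(L') ≤ dim k^Z + dim ker e + dim ker e' = deg Z + h⁰(L(−Z)) + h⁰(L'(−Z))`.  [CLIFFORD-G44 §1.3]
research route, not a corollary; conditional on HC_CM plus one named minimal statement. -/
theorem finrank_add_le_of_eval_orthogonal (B : LinearMap.BilinForm F W) (hB : B.Nondegenerate)
    (e : V →ₗ[F] W) (e' : V' →ₗ[F] W) (h : ∀ v : V, ∀ v' : V', B (e v) (e' v') = 0) :
    Module.finrank F V + Module.finrank F V' ≤
      Module.finrank F W + Module.finrank F (LinearMap.ker e) + Module.finrank F (LinearMap.ker e') := by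
  have key := finrank_add_finrank_le_of_orthogonal B hB (LinearMap.range e) (LinearMap.range e') (by
    rintro u ⟨v, rfl⟩ u' ⟨v', rfl⟩
    exact h v v')
  have r1 := LinearMap.finrank_range_add_finrank_ker e
  have r2 := LinearMap.finrank_range_add_finrank_ker e'
  omega

/-- The local model at the Weierstrass points outside `M`: a diagonal form with non-zero weights is non-degenerate.
[CLIFFORD-G44 §1.2–1.3]
research route, not a corollary; conditional on HC_CM plus one named minimal statement. -/
theorem diagonal_nondegenerate {ι : Type*} [DecidableEq ι] [Fintype ι] (α : ι → F) (hα : ∀ i, α i ≠ 0) :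
    (Matrix.toBilin' (Matrix.diagonal α)).Nondegenerate := by
  apply LinearMap.BilinForm.nondegenerate_toBilin'_of_det_ne_zero'
  rw [Matrix.det_diagonal]
  exact Finset.prod_ne_zero_iff.2 fun i _ => hα i

/-- The local model at an unramified fibre `{p, ιp}` (and, with jets, at the points of `M`): the hyperbolic plane
`(z_p, z_{ιp}) · (z'_p, z'_{ιp}) ↦ c (z_p z'_{ιp} + z_{ιp} z'_p)`, `c ≠ 0`, is non-degenerate.  [CLIFFORD-G44 §1.3, §6.1]
research route, not a corollary; conditional on HC_CM plus one named minimal statement. -/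
theorem hyperbolic_nondegenerate (c : F) (hc : c ≠ 0) :
    (Matrix.toBilin' (!![0, c; c, 0] : Matrix (Fin 2) (Fin 2) F)).Nondegenerate := by
  apply LinearMap.BilinForm.nondegenerate_toBilin'_of_det_ne_zero'
  rw [Matrix.det_fin_two_of]
  simpa using pow_ne_zero 2 hc

end linalg

section clifford

/-- The Clifford squeeze for `s = 2`: if `h, h' ≤ d/2 + 1` (Clifford's bound for the two line bundles `L(−Z)`, `L ⊗ ε(−Z)` of
degree `d ≤ 2g'−1`) and `h + h' ≥ d + 2` (LEMMA Λ), then BOTH are Clifford-extremal, `2h = 2h' = d + 2` (so `d` is even and, on a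
hyperelliptic curve, both are `(d/2)·g¹₂` — impossible when they differ by a non-zero 2-torsion class).  [CLIFFORD-G44 §1.4]
research route, not a corollary; conditional on HC_CM plus one named minimal statement. -/
theorem clifford_squeeze_two (h h' d : ℕ) (hc : 2 * h ≤ d + 2) (hc' : 2 * h' ≤ d + 2) (hΛ : d + 2 ≤ h + h') :
    2 * h = d + 2 ∧ 2 * h' = d + 2 := by omega

/-- The Clifford squeeze for `s = 1` (`(k,m) = (0,2)`): `h + h' ≥ d + 1` leaves three sub-cases — both extremal, or one extremal
and the other one short (then `d` is even), or `d` odd and both equal to `(d+1)/2` (a multiple of `g¹₂` plus one base point).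
[CLIFFORD-G44 §4.2]
research route, not a corollary; conditional on HC_CM plus one named minimal statement. -/
theorem clifford_squeeze_one (h h' d : ℕ) (hc : 2 * h ≤ d + 2) (hc' : 2 * h' ≤ d + 2) (hΛ : d + 1 ≤ h + h') :
    (2 * h = d + 2 ∧ 2 * h' = d + 2) ∨ (2 * h = d + 2 ∧ 2 * h' = d) ∨ (2 * h = d ∧ 2 * h' = d + 2) ∨
      (2 * h = d + 1 ∧ 2 * h' = d + 1) := by omega

/-- Degree window, `(k,m) = (2,0)` (THEOREM H): `dim V = dim V' = g'+1`, the reduced support has `1 ≤ m' ≤ 2g'+1` points,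
`d = 2g' − m'`; LEMMA Λ gives `h + h' + m' ≥ 2g'+2`; if `m' = 2g'+1` (`d = −1`, `h = h' = 0`) this is absurd, so `0 ≤ d ≤ 2g'−1`
and `h + h' ≥ d + 2`.  [CLIFFORD-G44 §2.2]
research route, not a corollary; conditional on HC_CM plus one named minimal statement. -/
theorem support_bound_20 (g m' h h' : ℕ) (hm : 1 ≤ m') (hm' : m' ≤ 2 * g + 1) (hΛ : 2 * g + 2 ≤ h + h' + m')
    (hvan : m' = 2 * g + 1 → h = 0 ∧ h' = 0) :
    m' ≤ 2 * g ∧ (2 * g - m') + 2 ≤ h + h' ∧ 2 * g - m' ≤ 2 * g - 1 := by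
  refine ⟨?_, ?_, ?_⟩ <;> [by_contra hc; skip; skip] <;> [have := hvan (by omega); skip; skip] <;> omega

/-- Degree window, `(k,m) = (1,2)` (THEOREM H′): support `1 ≤ m' ≤ 2g'` inside `W∖M`, `d = 2g' − m' ∈ [0, 2g'−1]`,
`h + h' ≥ 2(g'+1) − m' = d + 2`.  [CLIFFORD-G44 §3.1]
research route, not a corollary; conditional on HC_CM plus one named minimal statement. -/
theorem support_bound_12 (g m' h h' : ℕ) (hm : 1 ≤ m') (hm' : m' ≤ 2 * g) (hΛ : 2 * (g + 1) ≤ h + h' + m') :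
    (2 * g - m') + 2 ≤ h + h' ∧ 2 * g - m' ≤ 2 * g - 1 := by omega

/-- Degree window, `(k,m) = (0,4)` (THEOREM H′, `g' ≥ 2`): support `m'` points of `W∖M` (`|W∖M| = 2g'−2`) and `δ ∈ {0,1}` fibre,
`(m', δ) ≠ (0,0)`, quadratic space of dimension `m' + 2δ`, `d = 2g' − m' − 2δ ∈ [0, 2g'−1]`, `h + h' ≥ d + 2`.  [CLIFFORD-G44 §3.2]
research route, not a corollary; conditional on HC_CM plus one named minimal statement. -/
theorem support_bound_04 (g m' δ h h' : ℕ) (hg : 2 ≤ g) (hm' : m' ≤ 2 * g - 2) (hδ : δ ≤ 1) (hne : 1 ≤ m' + δ)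
    (hΛ : 2 * (g + 1) ≤ h + h' + (m' + 2 * δ)) :
    (2 * g - m' - 2 * δ) + 2 ≤ h + h' ∧ 2 * g - m' - 2 * δ ≤ 2 * g - 1 ∧ m' + 2 * δ ≤ 2 * g := by omega

/-- Degree window, `(k,m) = (0,2)` (THEOREM H″, `s = 1`): `dim V = dim V' = g'`, reduced support `1 ≤ m' ≤ 2g'−1` in `W∖M`,
`d = 2g' − 1 − m' ∈ [0, 2g'−2]`, and LEMMA Λ gives only `h + h' ≥ d + 1`.  [CLIFFORD-G44 §4.2]
research route, not a corollary; conditional on HC_CM plus one named minimal statement. -/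
theorem support_bound_02 (g m' h h' : ℕ) (hm : 1 ≤ m') (hm' : m' ≤ 2 * g - 1) (hΛ : 2 * g ≤ h + h' + m') :
    (2 * g - 1 - m') + 1 ≤ h + h' ∧ 2 * g - 1 - m' ≤ 2 * g - 2 := by omega

end clifford

section corank

open Polynomial

/-- The direct-sum lemma behind «corank EXACTLY one»: for coprime polynomials `p, q` the subspaces `p·Pol` and `q·Pol` meet
trivially below the degrees, i.e. `p a + q b = 0` with `deg b < deg p` forces `a = b = 0` (so
`dim (p·Pol_{≤A} + q·Pol_{≤B}) = (A+1) + (B+1)` whenever `B < deg p` — symmetrically `A < deg q`).  [CLIFFORD-G44 §2.3, §4.3]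
research route, not a corollary; conditional on HC_CM plus one named minimal statement. -/
theorem eq_zero_of_coprime_of_natDegree_lt {K : Type*} [Field K] (p q a b : K[X]) (hpq : IsCoprime p q)
    (h : p * a + q * b = 0) (hb : b.natDegree < p.natDegree) : a = 0 ∧ b = 0 := by
  have hqb : p ∣ q * b := ⟨-a, by linear_combination h⟩
  have hpb : p ∣ b := hpq.dvd_of_dvd_mul_left hqb
  have hb0 : b = 0 := by
    by_contra hne
    exact absurd (Polynomial.natDegree_le_of_dvd hpb hne) (not_le.2 hb)
  subst hb0
  have hp0 : p ≠ 0 := by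
    rintro rfl
    simp at hb
  have hpa : p * a = 0 := by simpa using h
  exact ⟨(mul_eq_zero.1 hpa).resolve_left hp0, rfl⟩

/-- The corank-one counts.  `(2,0)`, `D₀ = D_∞ + ε_S`, `|S| = 2g'−2j`: image `Π_S·Pol_{2j} ⊕ f_{W∖S}·Pol_{2g'−2−2j}` of dimension
`(2j+1) + (2g'−1−2j) = 2g' = (2g'+1) − 1`.  `(0,2)`, type I (`A ∋ w`, `|A| = 2j+1`, `1 ≤ j ≤ g'−1`):
`(2g'−1−2j) + (2j−1) = 2g'−2`; type II (`A ⊇ M`): `(2g'−2j) + (2j−2) = 2g'−2`; both `= (2g'−1) − 1`.  [CLIFFORD-G44 §2.3, §4.3]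
research route, not a corollary; conditional on HC_CM plus one named minimal statement. -/
theorem corank_one_counts (g j : ℕ) (hj : 1 ≤ j) (hjg : j ≤ g - 1) (hg : 1 ≤ g) :
    (2 * j + 1) + (2 * g - 1 - 2 * j) = (2 * g + 1) - 1 ∧
    (2 * g - 1 - 2 * j) + (2 * j - 1) = (2 * g - 1) - 1 ∧
    (2 * g - 2 * j) + (2 * j - 2) = (2 * g - 1) - 1 := by omega

/-- The trace target as functions on the Weierstrass points: a polynomial of degree `≤ N` vanishing at `N+1` distinct points is
zero, so `Pol_{≤2g'} ↪ k^W` (`|W| = 2g'+2`; image = the hyperplane `Σ_c R(c)/f'(c) = 0`), `Pol_{≤2g'−1} ≅ k^{W∖M}` for `|M| = 2`,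
etc.  [CLIFFORD-G44 §1.2]
research route, not a corollary; conditional on HC_CM plus one named minimal statement. -/
theorem eval_injective_of_card {K : Type*} [Field K] (N : ℕ) (s : Finset K) (hs : N + 1 ≤ s.card) (R : K[X])
    (hR : R.natDegree ≤ N) (hev : ∀ c ∈ s, R.eval c = 0) : R = 0 :=
  Polynomial.eq_zero_of_natDegree_lt_card_of_eval_eq_zero' R s hev (by omega)

end corank

section torsor

/-- `T' = (hδ − ιδ)/12` for the four `(k,m) = (2,0)` residue types (the pairs `(c, c')`, `c' ≡ hc (mod 12)`, at `(P, ιP)`):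
the coefficient of `P` is `(hc − c')/12`, of `ιP` is `(hc' − c)/12`.  `h = 5`: `(1,5) ↦ (0,2)`, `(9,9) ↦ (3,3)`, `(3,3) ↦ (1,1)`,
`(7,11) ↦ (2,4)`; `h = 7`: `(1,7) ↦ (0,4)`, `(8,8) ↦ (4,4)`, `(4,4) ↦ (2,2)`, `(5,11) ↦ (2,6)`.  [CLIFFORD-G44 §2.4]
research route, not a corollary; conditional on HC_CM plus one named minimal statement. -/
theorem tprime_table_20 :
    (List.map (fun t : ℕ × ℕ × ℕ => ((t.1 * t.2.1 - t.2.2) / 12, (t.1 * t.2.2 - t.2.1) / 12))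
      [(5, 1, 5), (5, 9, 9), (5, 3, 3), (5, 7, 11), (7, 1, 7), (7, 8, 8), (7, 4, 4), (7, 5, 11)])
      = [(0, 2), (3, 3), (1, 1), (2, 4), (0, 4), (4, 4), (2, 2), (2, 6)] ∧
    (List.map (fun t : ℕ × ℕ × ℕ => ((t.1 * t.2.1 - t.2.2) % 12, (t.1 * t.2.2 - t.2.1) % 12))
      [(5, 1, 5), (5, 9, 9), (5, 3, 3), (5, 7, 11), (7, 1, 7), (7, 8, 8), (7, 4, 4), (7, 5, 11)])
      = [(0, 0), (0, 0), (0, 0), (0, 0), (0, 0), (0, 0), (0, 0), (0, 0)] := by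
  decide

/-- The class conditions of the four `(2,0)` types reduced modulo `ιP_j ∼ D_∞ − P_j` (a divisor `a₁P₁ + b₁ιP₁ + a₂P₂ + b₂ιP₂ + dD_∞`
becomes `(a₁ − b₁)P₁ + (a₂ − b₂)P₂ + (d + b₁ + b₂)D_∞`).  With `e = 6` (`h = 5`) resp. `e = 4` (`h = 7`, `4D₀ = 12D₀ − 8D₀`)
the torsor is `e·D₀ ∼ (e+1)·D_∞ − 2P` for the `N`-point `P` of class `x¹, x⁷, x¹, x⁵` respectively:
`h = 5`: `6D₀ ∼ 2D_∞ + T'` reduces to `(−2, 0, 7)` for `N[1,9]` and `(0, −2, 7)` for `N[3,7]`, and `δ` to twice that;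
`h = 7`: `δ − 2D_∞ − T'` reduces to `(−2, 0, 5)` for `N[1,8]` and `(0, −2, 5)` for `N[4,5]`.  Hence `D₀ − D_∞ ∈ J[2]` would force
`2P ∼ D_∞`, i.e. `P` Weierstrass — impossible: NO member of these data has `D₀ ∈ D_∞ + J[2]`.  [CLIFFORD-G44 §2.4]
research route, not a corollary; conditional on HC_CM plus one named minimal statement. -/
theorem torsor_relations_20 :
    let red : ℤ × ℤ × ℤ × ℤ × ℤ → ℤ × ℤ × ℤ := fun v => (v.1 - v.2.1, v.2.2.1 - v.2.2.2.1, v.2.2.2.2 + v.2.1 + v.2.2.2.1)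
    -- h = 5, N[1,9]: δ = (1,5,9,9; 0), 2D_∞ + T' = (0,2,3,3; 2)
    red (0, 2, 3, 3, 2) = (-2, 0, 7) ∧ red (1, 5, 9, 9, 0) = (-4, 0, 14) ∧
    -- h = 5, N[3,7]: δ = (3,3,7,11; 0), 2D_∞ + T' = (1,1,2,4; 2)
    red (1, 1, 2, 4, 2) = (0, -2, 7) ∧ red (3, 3, 7, 11, 0) = (0, -4, 14) ∧
    -- h = 7, N[1,8]: δ − 2D_∞ − T' = (1,7,8,8; 0) − (0,4,4,4; 2) = (1,3,4,4; −2)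
    red (1, 3, 4, 4, -2) = (-2, 0, 5) ∧
    -- h = 7, N[4,5]: δ − 2D_∞ − T' = (4,4,5,11; 0) − (2,2,2,6; 2) = (2,2,3,5; −2)
    red (2, 2, 3, 5, -2) = (0, -2, 5) := by
  decide

/-- The class conditions of the `(0,2)` types (`s = 1`, `M = {w, w'}` with residues `(6,6)` at `h = 5`, `(4,8)` at `h = 7`):
`T' = ((h−1)v_w/12) w + ((h−1)v_{w'}/12) w'` has coefficients `(2,2)` resp. `(2,4)`; with `2w ∼ 2w' ∼ D_∞` the conditions
`12D₀ ∼ δ`, `(h+1)D₀ ∼ D_∞ + T'` read `12D₀ ∼ 6D_∞` and `6D₀ ∼ 3D_∞` (`h = 5`) resp. `8D₀ ∼ 4D_∞` (`h = 7`), i.e. `D₀ = w + X` with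
`X ∈ J[6]` resp. `J[4]` (`4 = 12 − 8`); connectedness (`Δ/2`, `Δ/3` non-principal) is `2X ≠ 0`, and `2D₀ ∼ D_∞ ⟺ 2X = 0`.
The numerical part: residue sums and `T'`-coefficients.  [CLIFFORD-G44 §4.4]
research route, not a corollary; conditional on HC_CM plus one named minimal statement. -/
theorem torsor_relations_02 :
    ((5 - 1) * 6 / 12 = 2 ∧ (7 - 1) * 4 / 12 = 2 ∧ (7 - 1) * 8 / 12 = 4) ∧
    (6 + 6 = 12 * 1 ∧ 4 + 8 = 12 * 1) ∧
    -- h = 5: 12 X = 0 and 6 X = 0 iff 6 X = 0; h = 7: 12 X = 0 and 8 X = 0 iff 4 X = 0 (orders in a cyclic group ZMod n model)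
    (∀ n : Fin 25, (12 * (n : ℕ) % 24 = 0 ∧ 6 * (n : ℕ) % 24 = 0) ↔ 6 * (n : ℕ) % 24 = 0) ∧
    (∀ n : Fin 25, (12 * (n : ℕ) % 24 = 0 ∧ 8 * (n : ℕ) % 24 = 0) ↔ 4 * (n : ℕ) % 24 = 0) := by
  refine ⟨by norm_num, by norm_num, by decide, by decide⟩

end torsor

end Summit.HodgeConjecture.Ring2AbelianAll.PrymTorelliClifford
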